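import Summits.QuantumFields.YangMills.Theorems.VirialFluxGapSharpTwistedLaplaceWindowArithmetic
import Mathlib
import HarnessLib

/-!
# LINE «tauber-mean» on crux ⟨stmt-QuantumFields-24141⟩ `VirialFluxGap.PeriodicSoftness` (planner ym-idea-4 g14, skeleton
# `bc/g14-A/PeriodicSoftness_tauber_birth.lean`): the stub `stub_windowArithmeticZero` BY NAME

The pure window arithmetic of the line: on Laplace windows `L ≤ β^a` with `a = θ/(4(q₁+10))` the thresholds of the Tauberian mean bound
(`β ≥ 2`, `κ((ρ+2)/β)^θ ≤ 1/4`, `64(ρ+2)²(1+|log v|+|log ℓ₀|+|log t₀|+log β) ≤ βt₀` with `ρ = 9L⁴ − 3/2`, `κ = t₀⁻¹ = ℓ₀⁻¹ = K₁L^{q₁}`,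
`|log v| ≤ K₁L^{q₁}`) hold eventually in `β`, and the error packs as `(4ρ+5)κ((ρ+2)/β)^θ + 2/β ≤ 1/2`.  Elementary: `ρ + 2 ≤ 10L⁴`,
`((ρ+2)/β)^θ ≤ 10 β^{θ(4a−1)}`, every monomial `L^r β^{s}` with `a r + s ≤ −3θ/4` is `≤ β^{−3θ/4} ≤ C₄⁻¹` once `β ≥ C₄^{4/(3θ)}`, and the
logarithmic threshold as in ✓`VirialFluxGapSharpTwistedLaplaceWindow.stub_windowArithmetic`.  The Prop `WindowArithmeticZero` is restated
CHARACTER-IDENTICALLY from the skeleton (namespace of this file).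

Mathlib only; no `sorry`; standard axioms.  HONEST LABEL: an S/M helper of a DRAFT-by-design second line; the heart `stub_periodicVolumeLaw`,
the crux 24141, the route and every summit statement are untouched; the Yang–Mills mass gap is NOT proved.  Width seat `ym-line-sfw-p2-w3`
g36 (cell ym-idea-1, free hands), `--supports stmt-QuantumFields-24141`.
-/

set_option autoImplicit false

noncomputable section

namespace Summit.QuantumFields.YangMills.Theorems.VirialFluxGapPeriodicSoftnessWindow

/-- Statement of `stub_windowArithmeticZero` (pure asymptotics on Laplace windows) — verbatim from the skeleton
`PeriodicSoftness_tauber_birth.lean` (LINE «tauber-mean», ym-idea-4 g14). [problem-side definition] -/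
def WindowArithmeticZero : Prop :=
  ∀ K₁ q₁ θ : ℝ, 0 < K₁ → 0 ≤ q₁ → 0 < θ → θ ≤ 1 → ∃ a : ℝ, 0 < a ∧ ∃ β₀ : ℝ, ∀ β : ℝ, β₀ ≤ β →
    ∀ L : ℕ, 1 ≤ L → (L : ℝ) ≤ β ^ a → ∀ w : ℝ, |w| ≤ K₁ * (L : ℝ) ^ q₁ →
      2 ≤ β ∧
      K₁ * (L : ℝ) ^ q₁ * ((9 * (L : ℝ) ^ 4 - 3 / 2 + 2) / β) ^ θ ≤ 1 / 4 ∧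
      64 * (9 * (L : ℝ) ^ 4 - 3 / 2 + 2) ^ 2 *
          (1 + |w| + |Real.log (K₁ * (L : ℝ) ^ q₁)⁻¹| + |Real.log (K₁ * (L : ℝ) ^ q₁)⁻¹| + Real.log β) ≤
        β * (K₁ * (L : ℝ) ^ q₁)⁻¹ ∧
      (4 * (9 * (L : ℝ) ^ 4 - 3 / 2) + 5) * (K₁ * (L : ℝ) ^ q₁) * ((9 * (L : ℝ) ^ 4 - 3 / 2 + 2) / β) ^ θ + 2 / β ≤ 1 / 2

open Summit.QuantumFields.YangMills.Theorems.VirialFluxGapSharpTwistedLaplaceWindow (le_rpow_half_of_sq_le)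

/-- `c ≤ β^{e}` once `c^{1/e} ≤ β` (`c ≥ 0`, `e > 0`). -/
theorem le_rpow_of_rpow_inv_le {c β e : ℝ} (hc : 0 ≤ c) (he : 0 < e) (h : c ^ (1 / e) ≤ β) : c ≤ β ^ e := by
  have h1 : (c ^ (1 / e)) ^ e ≤ β ^ e := Real.rpow_le_rpow (Real.rpow_nonneg hc _) h he.le
  rwa [← Real.rpow_mul hc, one_div_mul_cancel he.ne', Real.rpow_one] at h1

/-- ★ **`stub_windowArithmeticZero` BY NAME**: the window arithmetic of LINE «tauber-mean» holds with `a = θ/(4(q₁+10))`. [folklore] -/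
theorem stub_windowArithmeticZero : WindowArithmeticZero := by
  intro K₁ q₁ θ hK₁ hq₁ hθ hθ1
  obtain ⟨a, ha0, hadef⟩ : ∃ a : ℝ, 0 < a ∧ a = θ / (4 * (q₁ + 10)) := ⟨_, by positivity, rfl⟩
  have haθ : a ≤ 1 / (4 * (q₁ + 10)) := by
    rw [hadef]; exact div_le_div_of_nonneg_right hθ1 (by positivity)
  -- exponent inequalities
  have ha1 : a * (2 * q₁ + 9) ≤ 1 / 2 := by
    have h : 1 / (4 * (q₁ + 10)) * (2 * q₁ + 9) ≤ 1 / 2 := by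
      rw [div_mul_eq_mul_div, one_mul, div_le_iff₀ (by positivity)]; nlinarith
    exact (mul_le_mul_of_nonneg_right haθ (by linarith)).trans h
  have ha2 : a * (q₁ + 9) ≤ 1 / 2 := by
    have h : 1 / (4 * (q₁ + 10)) * (q₁ + 9) ≤ 1 / 2 := by
      rw [div_mul_eq_mul_div, one_mul, div_le_iff₀ (by positivity)]; nlinarith
    exact (mul_le_mul_of_nonneg_right haθ (by linarith)).trans h
  have ha4 : a * (q₁ + 8) ≤ θ / 4 := by
    rw [hadef, div_mul_eq_mul_div, div_le_div_iff₀ (by positivity) (by norm_num)]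
    nlinarith [mul_nonneg hθ.le hq₁]
  have hE₁ : a * q₁ + (4 * a - 1) * θ ≤ -(3 * θ / 4) := by nlinarith [mul_nonneg ha0.le hq₁]
  have hE₂ : 4 * a + a * q₁ + (4 * a - 1) * θ ≤ -(3 * θ / 4) := by nlinarith [mul_nonneg ha0.le hq₁]
  -- constants and threshold
  set C₃ : ℝ := 6400 * K₁ * (1 + K₁ + 2 * |Real.log K₁| + 2 * q₁ + 1 / a) with hC₃
  set C₄ : ℝ := 1440 * K₁ + 1 with hC₄
  have hC₃0 : 0 ≤ C₃ := by positivity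
  have hC₄0 : 0 ≤ C₄ := by positivity
  have h34 : 0 < 3 * θ / 4 := by positivity
  refine ⟨a, ha0, max 8 (max (C₃ ^ 2) (C₄ ^ (1 / (3 * θ / 4)))), ?_⟩
  intro β hβ L hL hLβ w hw
  have hβ8 : 8 ≤ β := le_trans (le_max_left _ _) hβ
  have hβC₃ : C₃ ^ 2 ≤ β := le_trans ((le_max_left _ _).trans (le_max_right _ _)) hβ
  have hβC₄ : C₄ ^ (1 / (3 * θ / 4)) ≤ β := le_trans ((le_max_right _ _).trans (le_max_right _ _)) hβ
  have hβ1 : 1 ≤ β := by linarith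
  have hβ0 : 0 < β := by linarith
  have hℓ1 : (1 : ℝ) ≤ L := by exact_mod_cast hL
  have hℓ0 : (0 : ℝ) < L := by linarith
  have hP1 : 1 ≤ (L : ℝ) ^ 4 := one_le_pow₀ hℓ1
  have hR1 : 1 ≤ (L : ℝ) ^ q₁ := Real.one_le_rpow hℓ1 hq₁
  have hR0 : 0 < (L : ℝ) ^ q₁ := by positivity
  have hκ0 : 0 < K₁ * (L : ℝ) ^ q₁ := by positivity
  -- `β^{1/2}` and `β^{3θ/4}`
  have hHH : β ^ (1 / 2 : ℝ) * β ^ (1 / 2 : ℝ) = β := by rw [← Real.rpow_add hβ0]; norm_num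
  have hHC₃ : C₃ ≤ β ^ (1 / 2 : ℝ) := le_rpow_half_of_sq_le hC₃0 hβC₃
  have hGC₄ : C₄ ≤ β ^ (3 * θ / 4) := le_rpow_of_rpow_inv_le hC₄0 h34 hβC₄
  have hG0 : 0 < β ^ (3 * θ / 4) := Real.rpow_pos_of_pos hβ0 _
  -- window monomials
  have hpowH : ∀ r : ℝ, 0 ≤ r → a * r ≤ 1 / 2 → (L : ℝ) ^ r ≤ β ^ (1 / 2 : ℝ) := by
    intro r hr har
    calc (L : ℝ) ^ r ≤ (β ^ a) ^ r := Real.rpow_le_rpow hℓ0.le hLβ hr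
      _ = β ^ (a * r) := by rw [← Real.rpow_mul hβ0.le]
      _ ≤ β ^ (1 / 2 : ℝ) := Real.rpow_le_rpow_of_exponent_le hβ1 har
  have hRβ : (L : ℝ) ^ q₁ ≤ β ^ (a * q₁) := by
    calc (L : ℝ) ^ q₁ ≤ (β ^ a) ^ q₁ := Real.rpow_le_rpow hℓ0.le hLβ hq₁
      _ = β ^ (a * q₁) := by rw [← Real.rpow_mul hβ0.le]
  have hPβ : (L : ℝ) ^ 4 ≤ β ^ (4 * a) := by
    calc (L : ℝ) ^ 4 ≤ (β ^ a) ^ 4 := pow_le_pow_left₀ hℓ0.le hLβ 4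
      _ = (β ^ a) ^ ((4 : ℕ) : ℝ) := (Real.rpow_natCast _ 4).symm
      _ = β ^ (4 * a) := by rw [← Real.rpow_mul hβ0.le]; ring_nf
  -- the Laplace factor `D = ((ρ+2)/β)^θ ≤ 10 β^{(4a−1)θ}`
  have hN0 : 0 < 9 * (L : ℝ) ^ 4 - 3 / 2 + 2 := by linarith only [hP1]
  have hN10 : 9 * (L : ℝ) ^ 4 - 3 / 2 + 2 ≤ 10 * (L : ℝ) ^ 4 := by linarith only [hP1]
  have hD : ((9 * (L : ℝ) ^ 4 - 3 / 2 + 2) / β) ^ θ ≤ 10 * β ^ ((4 * a - 1) * θ) := by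
    have h1 : (9 * (L : ℝ) ^ 4 - 3 / 2 + 2) / β ≤ 10 * β ^ (4 * a - 1) := by
      rw [Real.rpow_sub_one hβ0.ne', mul_div_assoc']
      exact div_le_div_of_nonneg_right (hN10.trans (by linarith only [hPβ])) hβ0.le
    calc ((9 * (L : ℝ) ^ 4 - 3 / 2 + 2) / β) ^ θ ≤ (10 * β ^ (4 * a - 1)) ^ θ :=
          Real.rpow_le_rpow (by positivity) h1 hθ.le
      _ = 10 ^ θ * β ^ ((4 * a - 1) * θ) := by
          rw [Real.mul_rpow (by norm_num) (Real.rpow_nonneg hβ0.le _), ← Real.rpow_mul hβ0.le]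
      _ ≤ 10 * β ^ ((4 * a - 1) * θ) := by
          have : (10 : ℝ) ^ θ ≤ 10 ^ (1 : ℝ) := Real.rpow_le_rpow_of_exponent_le (by norm_num) hθ1
          rw [Real.rpow_one] at this
          exact mul_le_mul_of_nonneg_right this (Real.rpow_nonneg hβ0.le _)
  have hD0 : 0 ≤ ((9 * (L : ℝ) ^ 4 - 3 / 2 + 2) / β) ^ θ := Real.rpow_nonneg (by positivity) _
  -- `κ·D ≤ 10K₁ β^{−3θ/4}` and `L⁴·κ·D ≤ 10K₁ β^{−3θ/4}`
  have hnegpow : β ^ (-(3 * θ / 4)) ≤ C₄⁻¹ := by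
    rw [Real.rpow_neg hβ0.le]
    exact inv_anti₀ (by positivity) hGC₄
  have hκD : K₁ * (L : ℝ) ^ q₁ * ((9 * (L : ℝ) ^ 4 - 3 / 2 + 2) / β) ^ θ ≤ 10 * K₁ * C₄⁻¹ := by
    have h1 : (L : ℝ) ^ q₁ * ((9 * (L : ℝ) ^ 4 - 3 / 2 + 2) / β) ^ θ ≤ β ^ (a * q₁) * (10 * β ^ ((4 * a - 1) * θ)) :=
      mul_le_mul hRβ hD hD0 (Real.rpow_nonneg hβ0.le _)
    have h2 : β ^ (a * q₁) * (10 * β ^ ((4 * a - 1) * θ)) = 10 * β ^ (a * q₁ + (4 * a - 1) * θ) := by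
      rw [Real.rpow_add hβ0]; ring
    have h3 : β ^ (a * q₁ + (4 * a - 1) * θ) ≤ β ^ (-(3 * θ / 4)) := Real.rpow_le_rpow_of_exponent_le hβ1 hE₁
    calc K₁ * (L : ℝ) ^ q₁ * ((9 * (L : ℝ) ^ 4 - 3 / 2 + 2) / β) ^ θ
        = K₁ * ((L : ℝ) ^ q₁ * ((9 * (L : ℝ) ^ 4 - 3 / 2 + 2) / β) ^ θ) := by ring
      _ ≤ K₁ * (10 * β ^ (a * q₁ + (4 * a - 1) * θ)) := by rw [← h2]; exact mul_le_mul_of_nonneg_left h1 hK₁.le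
      _ ≤ K₁ * (10 * C₄⁻¹) := by
          refine mul_le_mul_of_nonneg_left ?_ hK₁.le
          exact mul_le_mul_of_nonneg_left (h3.trans hnegpow) (by norm_num)
      _ = 10 * K₁ * C₄⁻¹ := by ring
  have hPκD : (L : ℝ) ^ 4 * (K₁ * (L : ℝ) ^ q₁) * ((9 * (L : ℝ) ^ 4 - 3 / 2 + 2) / β) ^ θ ≤ 10 * K₁ * C₄⁻¹ := by
    have h1 : (L : ℝ) ^ 4 * (L : ℝ) ^ q₁ * ((9 * (L : ℝ) ^ 4 - 3 / 2 + 2) / β) ^ θ ≤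
        β ^ (4 * a) * β ^ (a * q₁) * (10 * β ^ ((4 * a - 1) * θ)) :=
      mul_le_mul (mul_le_mul hPβ hRβ hR0.le (Real.rpow_nonneg hβ0.le _)) hD hD0 (by positivity)
    have h2 : β ^ (4 * a) * β ^ (a * q₁) * (10 * β ^ ((4 * a - 1) * θ)) = 10 * β ^ (4 * a + a * q₁ + (4 * a - 1) * θ) := by
      rw [Real.rpow_add hβ0, Real.rpow_add hβ0]; ring
    have h3 : β ^ (4 * a + a * q₁ + (4 * a - 1) * θ) ≤ β ^ (-(3 * θ / 4)) := Real.rpow_le_rpow_of_exponent_le hβ1 hE₂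
    calc (L : ℝ) ^ 4 * (K₁ * (L : ℝ) ^ q₁) * ((9 * (L : ℝ) ^ 4 - 3 / 2 + 2) / β) ^ θ
        = K₁ * ((L : ℝ) ^ 4 * (L : ℝ) ^ q₁ * ((9 * (L : ℝ) ^ 4 - 3 / 2 + 2) / β) ^ θ) := by ring
      _ ≤ K₁ * (10 * β ^ (4 * a + a * q₁ + (4 * a - 1) * θ)) := by rw [← h2]; exact mul_le_mul_of_nonneg_left h1 hK₁.le
      _ ≤ K₁ * (10 * C₄⁻¹) := by
          refine mul_le_mul_of_nonneg_left ?_ hK₁.le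
          exact mul_le_mul_of_nonneg_left (h3.trans hnegpow) (by norm_num)
      _ = 10 * K₁ * C₄⁻¹ := by ring
  have hC₄inv : K₁ * C₄⁻¹ ≤ 1 / 1440 := by
    rw [hC₄, ← div_eq_mul_inv, div_le_div_iff₀ (by positivity) (by norm_num)]
    linarith only [hK₁]
  -- (2') the Laplace threshold
  have hthr2 : K₁ * (L : ℝ) ^ q₁ * ((9 * (L : ℝ) ^ 4 - 3 / 2 + 2) / β) ^ θ ≤ 1 / 4 := by
    linarith only [hκD, hC₄inv]
  -- (4') the packed error
  have hpack : (4 * (9 * (L : ℝ) ^ 4 - 3 / 2) + 5) * (K₁ * (L : ℝ) ^ q₁) * ((9 * (L : ℝ) ^ 4 - 3 / 2 + 2) / β) ^ θ + 2 / β ≤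
      1 / 2 := by
    have h1 : (4 * (9 * (L : ℝ) ^ 4 - 3 / 2) + 5) * (K₁ * (L : ℝ) ^ q₁) * ((9 * (L : ℝ) ^ 4 - 3 / 2 + 2) / β) ^ θ ≤
        36 * ((L : ℝ) ^ 4 * (K₁ * (L : ℝ) ^ q₁) * ((9 * (L : ℝ) ^ 4 - 3 / 2 + 2) / β) ^ θ) := by
      have e : 36 * ((L : ℝ) ^ 4 * (K₁ * (L : ℝ) ^ q₁) * ((9 * (L : ℝ) ^ 4 - 3 / 2 + 2) / β) ^ θ) =
          (36 * (L : ℝ) ^ 4) * ((K₁ * (L : ℝ) ^ q₁) * ((9 * (L : ℝ) ^ 4 - 3 / 2 + 2) / β) ^ θ) := by ring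
      rw [e, mul_assoc]
      exact mul_le_mul_of_nonneg_right (by linarith only [hP1]) (mul_nonneg hκ0.le hD0)
    have h2 : 2 / β ≤ 1 / 4 := by rw [div_le_div_iff₀ hβ0 (by norm_num)]; linarith only [hβ8]
    linarith only [h1, hPκD, hC₄inv, h2]
  -- (3') the logarithmic threshold
  have hthr3 : 64 * (9 * (L : ℝ) ^ 4 - 3 / 2 + 2) ^ 2 *
      (1 + |w| + |Real.log (K₁ * (L : ℝ) ^ q₁)⁻¹| + |Real.log (K₁ * (L : ℝ) ^ q₁)⁻¹| + Real.log β) ≤ β * (K₁ * (L : ℝ) ^ q₁)⁻¹ := by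
    rw [le_mul_inv_iff₀ hκ0]
    have hlogκ : |Real.log (K₁ * (L : ℝ) ^ q₁)⁻¹| ≤ |Real.log K₁| + q₁ * (L : ℝ) := by
      rw [Real.log_inv, abs_neg, Real.log_mul hK₁.ne' hR0.ne', Real.log_rpow hℓ0]
      refine (abs_add_le _ _).trans (add_le_add le_rfl ?_)
      rw [abs_of_nonneg (mul_nonneg hq₁ (Real.log_nonneg hℓ1))]
      exact mul_le_mul_of_nonneg_left ((Real.log_le_sub_one_of_pos hℓ0).trans (by linarith only [hℓ1])) hq₁
    have hlogβ : Real.log β ≤ β ^ a / a := Real.log_le_rpow_div hβ0.le ha0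
    have hS : 1 + |w| + |Real.log (K₁ * (L : ℝ) ^ q₁)⁻¹| + |Real.log (K₁ * (L : ℝ) ^ q₁)⁻¹| + Real.log β ≤
        (1 + K₁ + 2 * |Real.log K₁| + 2 * q₁) * (L : ℝ) ^ (q₁ + 1) + β ^ a / a := by
      have h1 : 1 ≤ (L : ℝ) ^ (q₁ + 1) := Real.one_le_rpow hℓ1 (by linarith only [hq₁])
      have h2 : (L : ℝ) ^ q₁ ≤ (L : ℝ) ^ (q₁ + 1) := Real.rpow_le_rpow_of_exponent_le hℓ1 (by linarith only [hq₁])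
      have h3 : (L : ℝ) ≤ (L : ℝ) ^ (q₁ + 1) := by
        calc (L : ℝ) = (L : ℝ) ^ (1 : ℝ) := (Real.rpow_one _).symm
          _ ≤ (L : ℝ) ^ (q₁ + 1) := Real.rpow_le_rpow_of_exponent_le hℓ1 (by linarith only [hq₁])
      have habs : 0 ≤ |Real.log K₁| := abs_nonneg _
      have f1 := mul_le_mul_of_nonneg_left h2 hK₁.le
      have f2 := mul_le_mul_of_nonneg_left h3 hq₁
      have f3 := mul_le_mul_of_nonneg_left h1 habs
      have e : (1 + K₁ + 2 * |Real.log K₁| + 2 * q₁) * (L : ℝ) ^ (q₁ + 1) =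
          (L : ℝ) ^ (q₁ + 1) + K₁ * (L : ℝ) ^ (q₁ + 1) + 2 * (|Real.log K₁| * (L : ℝ) ^ (q₁ + 1)) +
            2 * (q₁ * (L : ℝ) ^ (q₁ + 1)) := by ring
      rw [e]
      linarith only [hw, hlogκ, hlogβ, h1, f1, f2, f3]
    have hS0 : 0 ≤ 1 + |w| + |Real.log (K₁ * (L : ℝ) ^ q₁)⁻¹| + |Real.log (K₁ * (L : ℝ) ^ q₁)⁻¹| + Real.log β := by
      have a1 := abs_nonneg w; have a2 := abs_nonneg (Real.log (K₁ * (L : ℝ) ^ q₁)⁻¹); have a3 := Real.log_nonneg hβ1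
      linarith only [a1, a2, a3]
    have hsq : (9 * (L : ℝ) ^ 4 - 3 / 2 + 2) ^ 2 ≤ 100 * ((L : ℝ) ^ 4 * (L : ℝ) ^ 4) := by
      have h11 : (1 : ℝ) ≤ (L : ℝ) ^ 4 * (L : ℝ) ^ 4 := one_le_mul_of_one_le_of_one_le hP1 hP1
      have hPP : (L : ℝ) ^ 4 ≤ (L : ℝ) ^ 4 * (L : ℝ) ^ 4 := le_mul_of_one_le_right (by positivity) hP1
      have e : (9 * (L : ℝ) ^ 4 - 3 / 2 + 2) ^ 2 = 81 * ((L : ℝ) ^ 4 * (L : ℝ) ^ 4) + 9 * (L : ℝ) ^ 4 + 1 / 4 := by ring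
      rw [e]
      linarith only [h11, hPP]
    have hq8 : (L : ℝ) ^ (q₁ + 8) = (L : ℝ) ^ q₁ * ((L : ℝ) ^ 4 * (L : ℝ) ^ 4) := by
      rw [Real.rpow_add hℓ0, show (8 : ℝ) = ((8 : ℕ) : ℝ) by norm_num, Real.rpow_natCast]; ring
    have h2q9 : (L : ℝ) ^ (2 * q₁ + 9) = (L : ℝ) ^ (q₁ + 8) * (L : ℝ) ^ (q₁ + 1) := by
      rw [← Real.rpow_add hℓ0]; ring_nf
    have hm1 : (L : ℝ) ^ (2 * q₁ + 9) ≤ β ^ (1 / 2 : ℝ) := hpowH _ (by linarith only [hq₁]) ha1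
    have hm2 : (L : ℝ) ^ (q₁ + 8) * β ^ a ≤ β ^ (1 / 2 : ℝ) := by
      have h1 : (L : ℝ) ^ (q₁ + 8) ≤ β ^ (a * (q₁ + 8)) := by
        calc (L : ℝ) ^ (q₁ + 8) ≤ (β ^ a) ^ (q₁ + 8) := Real.rpow_le_rpow hℓ0.le hLβ (by linarith only [hq₁])
          _ = β ^ (a * (q₁ + 8)) := by rw [← Real.rpow_mul hβ0.le]
      calc (L : ℝ) ^ (q₁ + 8) * β ^ a ≤ β ^ (a * (q₁ + 8)) * β ^ a :=
            mul_le_mul_of_nonneg_right h1 (Real.rpow_nonneg hβ0.le _)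
        _ = β ^ (a * (q₁ + 9)) := by rw [← Real.rpow_add hβ0]; ring_nf
        _ ≤ β ^ (1 / 2 : ℝ) := Real.rpow_le_rpow_of_exponent_le hβ1 ha2
    have hA : 64 * (9 * (L : ℝ) ^ 4 - 3 / 2 + 2) ^ 2 *
        (1 + |w| + |Real.log (K₁ * (L : ℝ) ^ q₁)⁻¹| + |Real.log (K₁ * (L : ℝ) ^ q₁)⁻¹| + Real.log β) * (K₁ * (L : ℝ) ^ q₁) ≤
        6400 * K₁ * (L : ℝ) ^ (q₁ + 8) * ((1 + K₁ + 2 * |Real.log K₁| + 2 * q₁) * (L : ℝ) ^ (q₁ + 1) + β ^ a / a) := by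
      rw [hq8]
      have h1 : 64 * (9 * (L : ℝ) ^ 4 - 3 / 2 + 2) ^ 2 * (K₁ * (L : ℝ) ^ q₁) ≤
          6400 * K₁ * ((L : ℝ) ^ q₁ * ((L : ℝ) ^ 4 * (L : ℝ) ^ 4)) := by
        have h := mul_le_mul_of_nonneg_right hsq hκ0.le
        have e : 6400 * K₁ * ((L : ℝ) ^ q₁ * ((L : ℝ) ^ 4 * (L : ℝ) ^ 4)) = 64 * (100 * ((L : ℝ) ^ 4 * (L : ℝ) ^ 4) * (K₁ * (L : ℝ) ^ q₁)) := by
          ring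
        rw [e]
        linarith only [h]
      have h2 : 0 ≤ 6400 * K₁ * ((L : ℝ) ^ q₁ * ((L : ℝ) ^ 4 * (L : ℝ) ^ 4)) := by positivity
      calc 64 * (9 * (L : ℝ) ^ 4 - 3 / 2 + 2) ^ 2 *
            (1 + |w| + |Real.log (K₁ * (L : ℝ) ^ q₁)⁻¹| + |Real.log (K₁ * (L : ℝ) ^ q₁)⁻¹| + Real.log β) * (K₁ * (L : ℝ) ^ q₁)
          = (64 * (9 * (L : ℝ) ^ 4 - 3 / 2 + 2) ^ 2 * (K₁ * (L : ℝ) ^ q₁)) *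
              (1 + |w| + |Real.log (K₁ * (L : ℝ) ^ q₁)⁻¹| + |Real.log (K₁ * (L : ℝ) ^ q₁)⁻¹| + Real.log β) := by ring
        _ ≤ (6400 * K₁ * ((L : ℝ) ^ q₁ * ((L : ℝ) ^ 4 * (L : ℝ) ^ 4))) *
              ((1 + K₁ + 2 * |Real.log K₁| + 2 * q₁) * (L : ℝ) ^ (q₁ + 1) + β ^ a / a) := mul_le_mul h1 hS hS0 h2
    have hB : 6400 * K₁ * (L : ℝ) ^ (q₁ + 8) * ((1 + K₁ + 2 * |Real.log K₁| + 2 * q₁) * (L : ℝ) ^ (q₁ + 1) + β ^ a / a) ≤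
        C₃ * β ^ (1 / 2 : ℝ) := by
      have e : 6400 * K₁ * (L : ℝ) ^ (q₁ + 8) * ((1 + K₁ + 2 * |Real.log K₁| + 2 * q₁) * (L : ℝ) ^ (q₁ + 1) + β ^ a / a) =
          6400 * K₁ * (1 + K₁ + 2 * |Real.log K₁| + 2 * q₁) * ((L : ℝ) ^ (q₁ + 8) * (L : ℝ) ^ (q₁ + 1)) +
            6400 * K₁ * (1 / a) * ((L : ℝ) ^ (q₁ + 8) * β ^ a) := by
        field_simp
      rw [e, ← h2q9, hC₃]
      have f1 := mul_le_mul_of_nonneg_left hm1 (by positivity : 0 ≤ 6400 * K₁ * (1 + K₁ + 2 * |Real.log K₁| + 2 * q₁))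
      have f2 := mul_le_mul_of_nonneg_left hm2 (by positivity : 0 ≤ 6400 * K₁ * (1 / a))
      have e2 : 6400 * K₁ * (1 + K₁ + 2 * |Real.log K₁| + 2 * q₁ + 1 / a) * β ^ (1 / 2 : ℝ) =
          6400 * K₁ * (1 + K₁ + 2 * |Real.log K₁| + 2 * q₁) * β ^ (1 / 2 : ℝ) + 6400 * K₁ * (1 / a) * β ^ (1 / 2 : ℝ) := by ring
      rw [e2]
      linarith only [f1, f2]
    calc 64 * (9 * (L : ℝ) ^ 4 - 3 / 2 + 2) ^ 2 *
          (1 + |w| + |Real.log (K₁ * (L : ℝ) ^ q₁)⁻¹| + |Real.log (K₁ * (L : ℝ) ^ q₁)⁻¹| + Real.log β) * (K₁ * (L : ℝ) ^ q₁)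
        ≤ C₃ * β ^ (1 / 2 : ℝ) := hA.trans hB
      _ ≤ β ^ (1 / 2 : ℝ) * β ^ (1 / 2 : ℝ) := mul_le_mul_of_nonneg_right hHC₃ (by positivity)
      _ = β := hHH
  exact ⟨by linarith only [hβ8], hthr2, hthr3, hpack⟩

end Summit.QuantumFields.YangMills.Theorems.VirialFluxGapPeriodicSoftnessWindow

end
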